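import Literature.Combinatorics.StablePolynomials.NegativeLatticeCondition
import HarnessLib

/-!
# Deletion and polarised-derivative families of a stable multi-affine coefficient family

(draft) Topic `Literature/Combinatorics/StablePolynomials`.
-/

noncomputable section

namespace Literature.Combinatorics.StablePolynomials

open MvPolynomial Finset Filter Topology
open scoped BigOperators

variable {σ : Type*} [Fintype σ] [DecidableEq σ]

/-- **The derivative family keeps "stable or zero"**: if the real family `a` is identically zero
or `Σ_S a(S) z^S` is zero-free on `H^σ`, then so is `S ↦ [x ∉ S]·a(S ∪ x)`, the coefficient
family of `∂_x Σ_S a(S) z^S` (Wagner 2011, Lemma 2.4 (f): `∂_x` of a stable polynomial is `0` or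
stable; coefficients by `pderiv_multiAffine`). [cite: Wagner2011, Lemma 2.4 (f)] -/
theorem multiAffine_stableOrZero_derivFamily (a : Finset σ → ℝ)
    (ha : (∀ S, a S = 0) ∨
      ∀ z : σ → ℂ, (∀ i, 0 < (z i).im) → (∑ S : Finset σ, (a S : ℂ) * ∏ i ∈ S, z i) ≠ 0)
    (x : σ) :
    (∀ S, (if x ∈ S then 0 else a (insert x S)) = 0) ∨
      ∀ z : σ → ℂ, (∀ i, 0 < (z i).im) →
        (∑ S : Finset σ, ((if x ∈ S then 0 else a (insert x S) : ℝ) : ℂ) * ∏ i ∈ S, z i) ≠ 0 := by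
  classical
  rcases ha with ha | ha
  · left
    intro S
    simp [ha]
  · have hP : IsUpperHalfPlaneStable (multiAffine fun S => (a S : ℂ)) :=
      (isUpperHalfPlaneStable_multiAffine_iff _).2 ha
    have h := hP.pderiv x
    rw [pderiv_multiAffine] at h
    have hfam : (fun S => if x ∈ S then (0 : ℂ) else (a (insert x S) : ℂ)) =
        fun S => (((if x ∈ S then 0 else a (insert x S) : ℝ)) : ℂ) := by
      funext S
      by_cases hx : x ∈ S <;> simp [hx]
    rw [hfam] at h
    rcases h with h | h
    · left
      intro S
      have := (multiAffine_eq_zero_iff _).1 h S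
      exact_mod_cast this
    · right
      exact (isUpperHalfPlaneStable_multiAffine_iff _).1 h

omit [DecidableEq σ] in
/-- The coefficient form is additive in the coefficients. [folklore] -/
theorem multiAffine_finset_sum {ι : Type*} (s : Finset ι) (f : ι → Finset σ → ℂ) :
    multiAffine (fun S => ∑ y ∈ s, f y S) = ∑ y ∈ s, multiAffine (f y) := by
  simp only [multiAffine, map_sum, Finset.sum_mul]
  rw [Finset.sum_comm]

omit [Fintype σ] in
/-- `∂_y` of a product of affine factors in distinct variables removes the `y`-factor:
`∂_y ∏_{i ∈ s} (zᵢ + cᵢ) = [y ∈ s] ∏_{i ∈ s ∖ y} (zᵢ + cᵢ)`. [folklore] -/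
theorem pderiv_prod_X_add_C (s : Finset σ) (c : σ → ℂ) (y : σ) :
    pderiv y (∏ i ∈ s, (X i + C (c i) : MvPolynomial σ ℂ)) =
      if y ∈ s then ∏ i ∈ s.erase y, (X i + C (c i)) else 0 := by
  classical
  induction s using Finset.induction_on with
  | empty => simp
  | insert j s hj ih =>
    rw [Finset.prod_insert hj, Derivation.leibniz, ih, smul_eq_mul, smul_eq_mul]
    have hdj : pderiv y (X j + C (c j) : MvPolynomial σ ℂ) = if y = j then 1 else 0 := by
      rw [map_add, pderiv_C, add_zero, pderiv_X]
      simp [Pi.single_apply, eq_comm]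
    rw [hdj]
    by_cases hyj : y = j
    · subst hyj
      rw [if_pos rfl, if_neg hj, if_pos (Finset.mem_insert_self y s), Finset.erase_insert hj]
      ring
    · rw [if_neg hyj]
      by_cases hys : y ∈ s
      · rw [if_pos hys, if_pos (Finset.mem_insert_of_mem hys), Finset.erase_insert_of_ne (Ne.symm hyj),
          Finset.prod_insert (fun h => hj (Finset.mem_of_mem_erase h))]
        ring
      · rw [if_neg hys, if_neg]
        · ring
        · rw [Finset.mem_insert]
          push Not
          exact ⟨hyj, hys⟩

/-- **The polarised-derivative family keeps "stable or zero"** (Borcea–Brändén symbol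
criterion for `T = Σ_y ∂_y`): if the real family `a` is identically zero or `Σ_S a(S) z^S` is
zero-free on `H^σ`, then so is `S ↦ Σ_{y ∉ S} a(S ∪ y)`, the coefficient family of
`Σ_y ∂_y Σ_S a(S) z^S`. The symbol of `T` is `Σ_y ∏_{i ≠ y}(zᵢ + wᵢ) = ∏ᵢ(zᵢ + wᵢ)·Σ_y (z_y + w_y)⁻¹`,
zero-free on `H^σ × H^σ` because every `(z_y + w_y)⁻¹` has negative imaginary part; then
Borcea–Brändén's Lemma 2.2 (`multiAffine_stabilityPreserver_sufficiency`, proved in the tree).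
[cite: BorceaBranden2009, §2.1, Lemma 2.2] -/
theorem multiAffine_stableOrZero_sumInsertFamily (a : Finset σ → ℝ)
    (ha : (∀ S, a S = 0) ∨
      ∀ z : σ → ℂ, (∀ i, 0 < (z i).im) → (∑ S : Finset σ, (a S : ℂ) * ∏ i ∈ S, z i) ≠ 0) :
    (∀ S, (∑ y ∈ Sᶜ, a (insert y S)) = 0) ∨
      ∀ z : σ → ℂ, (∀ i, 0 < (z i).im) →
        (∑ S : Finset σ, ((∑ y ∈ Sᶜ, a (insert y S) : ℝ) : ℂ) * ∏ i ∈ S, z i) ≠ 0 := by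
  classical
  rcases isEmpty_or_nonempty σ with hσ | hσ
  · left
    intro S
    exact Finset.sum_eq_zero fun y _ => (IsEmpty.false y).elim
  rcases ha with ha | ha
  · left
    intro S
    simp [ha]
  -- the operator and its action on the coefficient form
  set T : MvPolynomial σ ℂ →ₗ[ℂ] MvPolynomial σ ℂ := ∑ y : σ, (pderiv y).toLinearMap with hT
  have hTapply : ∀ p : MvPolynomial σ ℂ, T p = ∑ y : σ, pderiv y p := fun p => by
    simp [hT, LinearMap.sum_apply]
  have hTa : T (multiAffine fun S => (a S : ℂ)) =
      multiAffine (fun S => (((∑ y ∈ Sᶜ, a (insert y S) : ℝ)) : ℂ)) := by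
    rw [hTapply]
    simp only [pderiv_multiAffine]
    rw [← multiAffine_finset_sum]
    congr 1
    funext S
    push_cast
    rw [← Finset.sum_filter_add_sum_filter_not univ (fun y => y ∈ S)]
    rw [Finset.sum_eq_zero (fun y hy => by rw [Finset.mem_filter] at hy; rw [if_pos hy.2]), zero_add]
    have hc : univ.filter (fun y => ¬ y ∈ S) = Sᶜ := by ext y; simp
    rw [hc]
    exact Finset.sum_congr rfl fun y hy => by rw [if_neg (Finset.mem_compl.1 hy)]
  -- the symbol is stable
  have hG : IsUpperHalfPlaneStable (multiAffineSymbol T) := by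
    intro zw hzw
    have hsplit : zw = Sum.elim (zw ∘ Sum.inl) (zw ∘ Sum.inr) := (Sum.elim_comp_inl_inr zw).symm
    rw [hsplit, eval_multiAffineSymbol, hTapply, map_sum]
    simp only [pderiv_prod_X_add_C, Finset.mem_univ, if_true, map_prod, map_add, eval_X, eval_C,
      Function.comp_apply]
    set z := zw ∘ Sum.inl with hz
    set w := zw ∘ Sum.inr with hw
    have hzi : ∀ i, 0 < (zw (Sum.inl i)).im := fun i => hzw _
    have hwi : ∀ i, 0 < (zw (Sum.inr i)).im := fun i => hzw _
    have hne : ∀ i, zw (Sum.inl i) + zw (Sum.inr i) ≠ 0 := fun i h => by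
      have := congrArg Complex.im h
      simp only [Complex.add_im, Complex.zero_im] at this
      linarith [hzi i, hwi i]
    set P := ∏ i : σ, (zw (Sum.inl i) + zw (Sum.inr i)) with hP
    have hP0 : P ≠ 0 := Finset.prod_ne_zero_iff.2 fun i _ => hne i
    have herase : ∀ y : σ, ∏ i ∈ univ.erase y, (zw (Sum.inl i) + zw (Sum.inr i)) =
        P * (zw (Sum.inl y) + zw (Sum.inr y))⁻¹ := by
      intro y
      rw [hP, ← Finset.mul_prod_erase univ _ (Finset.mem_univ y)]
      field_simp [hne y]
    simp only [herase, ← Finset.mul_sum]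
    refine mul_ne_zero hP0 ?_
    -- the sum of the inverses has negative imaginary part
    have him : ∀ y : σ, ((zw (Sum.inl y) + zw (Sum.inr y))⁻¹).im < 0 := by
      intro y
      rw [Complex.inv_im, div_neg_iff]
      right
      refine ⟨?_, Complex.normSq_pos.2 (hne y)⟩
      simp only [Complex.add_im, Left.neg_neg_iff]
      linarith [hzi y, hwi y]
    intro h
    have := congrArg Complex.im h
    rw [Complex.im_sum, Complex.zero_im] at this
    obtain ⟨y₀⟩ := hσ
    have hlt : ∑ y : σ, ((zw (Sum.inl y) + zw (Sum.inr y))⁻¹).im < 0 :=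
      Finset.sum_neg (fun y _ => him y) ⟨y₀, Finset.mem_univ _⟩
    linarith
  have hs : IsUpperHalfPlaneStable (multiAffine fun S => (a S : ℂ)) :=
    (isUpperHalfPlaneStable_multiAffine_iff _).2 ha
  have key := multiAffine_stabilityPreserver_sufficiency T hG (isMultiAffine_multiAffine _) hs
  rw [hTa] at key
  rcases key with h | h
  · right
    exact (isUpperHalfPlaneStable_multiAffine_iff _).1 h
  · left
    intro S
    have := (multiAffine_eq_zero_iff _).1 h S
    exact_mod_cast this

end Literature.Combinatorics.StablePolynomials

end
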